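import Summits.AnomalousDissipation.AnomalousDissipation.Theorems.NeutralTaylorWavesTaylorWaveQuasiSteadyLine
import Literature.Analysis.FunctionSpaces.TorusAxisAverageCalculus

/-!
# Tools for the stub `stub_dissipationLawW` of the line `windfibred`
# (crux stmt-AnomalousDissipation-16293, `NeutralTaylorWaves.TaylorWaveQuasiSteady`)

Torus bookkeeping used by the Taylor dissipation law `ν_n‖∇(P ∘ e_n)‖₂² = ∫_{T⁴} |k|²‖∂_θP‖² + O(ε_n)`
(`NeutralTaylorWavesTaylorWaveQuasiSteadyStubDissipationLawW`), for the two-scale evaluation map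
`e_n = phaseMap j G n : T³ → T⁴`, `x ↦ (x, θ_n x)`, `θ_n = fastPhase j G n` of the vocabulary file
`NeutralTaylorWavesTaylorWaveQuasiSteadyLine`:

* §1 axis translations on `T^d`: the mean value inequality along a coordinate axis
  (`norm_sub_le_of_norm_partialDeriv_le`, from `Torus.hasDerivAt_comp_add_proj_smul` and Mathlib's
  `Convex.norm_image_sub_le_of_norm_hasDerivWithin_le`) and invariance along an axis on which the partial
  derivative vanishes; uniform bounds of finitely many continuous functions on a compact space;
* §2 Fubini `T^{k+1} = T¹ × T^k` through `Fin.snoc` (phase = LAST coordinate; Mathlib's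
  `measurePreserving_piFinSuccAbove` at `Fin.last k`, `integral_prod(_symm)`), the `Fin.snoc` twin of
  `Torus.integral_eq_integral_cons` (`TorusTimePeriodicLift`);
* §3 the evaluation map: `slow ∘ e_n = id`, continuity, and the TRANSLATION IDENTITY
  `e_n (x + t eᵢ) = e_n x + t e_{i.castSucc} + ((n+1)(jᵢ t + G(x + t eᵢ) − G x)) e_last`
  (`phaseMap_add_single`), whence
* §4 the FIRST-ORDER CHAIN RULE `∂ᵢ(Φ ∘ e_n)(x) = ∂_{i.castSucc}Φ(e_n x) + ((n+1) kᵢ(x)) • ∂_θΦ(e_n x)`,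
  `kᵢ = ∂ᵢG + jᵢ` (`partialDeriv_comp_phaseMap`): the curve `t ↦ e_n(x + t eᵢ)` is `e_n x + proj (γ t)` with
  `γ t = t e_{i.castSucc} + g(t) e_last`, so `Φ ∘ e_n` along it is the re-centred lift `liftAt Φ (e_n x) ∘ γ`,
  differentiated by `HasFDerivAt.comp_hasDerivAt`.

The file ends with the registered tools stub `stub_dissipationLawWTools` (conjunction of the exported facts).
Source: folklore (two-scale calculus of monophase profiles `U(x, φ(x)/ε)`; Cheverry–Guès–Métivier,
Ann. Sci. ENS 36 (2003) §2).
-/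

-- `Summit.<Summit>.<Problem>` is the tree's mandated summit-side namespace (CONVENTIONS §2); for this
-- single-conjunct summit the two coincide, so the duplicate is deliberate.
set_option linter.dupNamespace false

noncomputable section

open scoped BigOperators Topology InnerProductSpace
open Filter MeasureTheory Set
open Literature.Analysis.FunctionSpaces Literature.Analysis.FunctionSpaces.Torus

namespace Summit.AnomalousDissipation.AnomalousDissipation.Theorems.TaylorWaveQuasiSteady.DissipationLaw

open Summit.AnomalousDissipation.AnomalousDissipation.Theorems.TaylorWaveQuasiSteady

/-! ## §1 Axis translations on `T^d`; uniform bounds -/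

section Axis

variable {d : Type*} [Fintype d] [DecidableEq d]
variable {F : Type*} [NormedAddCommGroup F] [NormedSpace ℝ F]

/-- **Mean value inequality along a coordinate axis of the torus**: if `‖∂ₘ f‖ ≤ C` everywhere then
`‖f (z + t eₘ) - f z‖ ≤ C |t|` (`t ↦ f (z + proj (t eₘ))` has derivative `∂ₘ f` at the moving point). [folklore] -/
theorem norm_sub_le_of_norm_partialDeriv_le {f : UnitAddTorus d → F} (hf : IsContDiff 1 f) (m : d) {C : ℝ}
    (hC : ∀ z, ‖partialDeriv m f z‖ ≤ C) (z : UnitAddTorus d) (t : ℝ) :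
    ‖f (z + Pi.single m (t : UnitAddCircle)) - f z‖ ≤ C * |t| := by
  have hderiv : ∀ s : ℝ, HasDerivAt (fun s : ℝ => f (z + proj (s • EuclideanSpace.single m (1 : ℝ))))
      (partialDeriv m f (z + proj (s • EuclideanSpace.single m (1 : ℝ)))) s :=
    fun s => hasDerivAt_comp_add_proj_smul hf z _ s
  have h := convex_univ.norm_image_sub_le_of_norm_hasDerivWithin_le
    (fun s _ => (hderiv s).hasDerivWithinAt) (fun s _ => hC _) (mem_univ 0) (mem_univ t)
  simp only [zero_smul, proj_zero, add_zero, sub_zero, Real.norm_eq_abs, proj_smul_single] at h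
  exact h

/-- **Invariance along an axis on which the partial derivative vanishes**: `∂ₘ f ≡ 0` implies
`f (z + s eₘ) = f z` for every `s : ℝ/ℤ` (the mean value inequality with constant `0`). [folklore] -/
theorem apply_add_single_eq_of_partialDeriv_eq_zero {f : UnitAddTorus d → F} (hf : IsContDiff 1 f) (m : d)
    (h0 : ∀ z, partialDeriv m f z = 0) (z : UnitAddTorus d) (s : UnitAddCircle) :
    f (z + Pi.single m s) = f z := by
  obtain ⟨t, rfl⟩ := QuotientAddGroup.mk_surjective s
  have h := norm_sub_le_of_norm_partialDeriv_le hf m (C := 0) (fun z => by rw [h0, norm_zero]) z t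
  rw [zero_mul] at h
  exact sub_eq_zero.1 (norm_le_zero_iff.1 h)

omit [Fintype d] [DecidableEq d] in
/-- Every point of `ℝ/ℤ` is represented by a real number in `[0, 1)`. [folklore] -/
theorem exists_mem_Ico_coe_eq (s : UnitAddCircle) : ∃ r : ℝ, r ∈ Ico (0 : ℝ) 1 ∧ (r : UnitAddCircle) = s := by
  refine ⟨(AddCircle.equivIco (1 : ℝ) (0 : ℝ) s : ℝ), ?_, (AddCircle.equivIco (1 : ℝ) (0 : ℝ)).symm_apply_apply s⟩
  have h := (AddCircle.equivIco (1 : ℝ) (0 : ℝ) s).2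
  simpa using h

omit [Fintype d] [DecidableEq d] in
/-- `m • ↑r = ↑(m r)` in `ℝ/ℤ` for an integer `m`. [folklore] -/
theorem zsmul_coe_unitAddCircle (m : ℤ) (r : ℝ) :
    m • ((r : ℝ) : UnitAddCircle) = (((m : ℝ) * r : ℝ) : UnitAddCircle) := by
  rw [← AddCircle.coe_zsmul, zsmul_eq_mul]

omit [Fintype d] [DecidableEq d] [NormedSpace ℝ F] in
/-- Finitely many continuous functions on a compact space admit a common nonnegative bound. [folklore] -/
theorem exists_forall_norm_le {X : Type*} [TopologicalSpace X] [CompactSpace X] {ι : Type*} [Fintype ι]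
    (f : ι → X → F) (hf : ∀ i, Continuous (f i)) : ∃ K : ℝ, 0 ≤ K ∧ ∀ i x, ‖f i x‖ ≤ K := by
  have hK : ∀ i, ∃ K : ℝ, ∀ x, ‖f i x‖ ≤ K := fun i => by
    obtain ⟨K, hK⟩ := isCompact_univ.exists_bound_of_continuousOn (hf i).continuousOn
    exact ⟨K, fun x => hK x (mem_univ x)⟩
  choose K hK using hK
  refine ⟨∑ i, |K i|, Finset.sum_nonneg fun i _ => abs_nonneg _, fun i x => (hK i x).trans ?_⟩
  exact (le_abs_self _).trans (Finset.single_le_sum (f := fun l => |K l|) (fun l _ => abs_nonneg _) (Finset.mem_univ i))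

end Axis

/-! ## §2 Fubini on `T^{k+1} = T¹ × T^k` through `Fin.snoc` -/

section Snoc

variable {k : ℕ}
variable {F : Type*} [NormedAddCommGroup F] [NormedSpace ℝ F]

/-- `(s, x) ↦ Fin.snoc x s : T¹ × T^k → T^{k+1}` is continuous. [folklore] -/
theorem continuous_snoc_prod (k : ℕ) :
    Continuous fun p : UnitAddCircle × UnitAddTorus (Fin k) =>
      (@Fin.snoc k (fun _ => UnitAddCircle) p.2 p.1 : UnitAddTorus (Fin (k + 1))) := by
  refine continuous_pi fun m => ?_
  refine Fin.lastCases ?_ (fun l => ?_) m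
  · simp only [Fin.snoc_last]
    exact continuous_fst
  · simp only [Fin.snoc_castSucc]
    exact (continuous_apply l).comp continuous_snd

/-- Translating the last coordinate: `Fin.snoc x a + b e_last = Fin.snoc x (a + b)`. [folklore] -/
theorem snoc_add_single_last (x : UnitAddTorus (Fin k)) (a b : UnitAddCircle) :
    (@Fin.snoc k (fun _ => UnitAddCircle) x a : UnitAddTorus (Fin (k + 1))) + Pi.single (Fin.last k) b =
      @Fin.snoc k (fun _ => UnitAddCircle) x (a + b) := by
  funext m
  refine Fin.lastCases ?_ (fun l => ?_) m
  · simp only [Pi.add_apply, Fin.snoc_last, Pi.single_eq_same]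
  · simp only [Pi.add_apply, Fin.snoc_castSucc, Pi.single_eq_of_ne (Fin.castSucc_lt_last l).ne, add_zero]

/-- **The product torus as `T¹ × T^k` through `Fin.snoc`** (no integrability needed):
`∫_{T^{k+1}} Φ = ∫_{(s, x) ∈ T¹ × T^k} Φ (Fin.snoc x s)` (Mathlib's `measurePreserving_piFinSuccAbove` at the
index `Fin.last k`, whose inverse is `Fin.snoc`). [folklore] -/
theorem integral_eq_integral_snoc_prod (Φ : UnitAddTorus (Fin (k + 1)) → F) :
    ∫ y, Φ y = ∫ p : UnitAddCircle × UnitAddTorus (Fin k), Φ (@Fin.snoc k (fun _ => UnitAddCircle) p.2 p.1) := by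
  have hmp := measurePreserving_piFinSuccAbove (fun _ : Fin (k + 1) => (volume : Measure UnitAddCircle)) (Fin.last k)
  have hvol : (volume : Measure (UnitAddTorus (Fin (k + 1)))) =
      Measure.pi fun _ : Fin (k + 1) => (volume : Measure UnitAddCircle) := rfl
  have h1 : (fun y => Φ y) = fun y : UnitAddTorus (Fin (k + 1)) =>
      (fun p : UnitAddCircle × UnitAddTorus (Fin k) => Φ (@Fin.snoc k (fun _ => UnitAddCircle) p.2 p.1))
        (MeasurableEquiv.piFinSuccAbove (fun _ : Fin (k + 1) => UnitAddCircle) (Fin.last k) y) := by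
    funext y
    change Φ y = Φ (Fin.snoc (fun j => y ((Fin.last k).succAbove j)) (y (Fin.last k)))
    simp only [Fin.succAbove_last]
    exact congrArg Φ (Fin.snoc_init_self y).symm
  rw [h1, hvol, hmp.integral_comp' (fun p : UnitAddCircle × UnitAddTorus (Fin k) =>
    Φ (@Fin.snoc k (fun _ => UnitAddCircle) p.2 p.1))]
  rfl

omit [NormedSpace ℝ F] in
/-- Continuous functions read through `Fin.snoc` are integrable on `T¹ × T^k`. [folklore] -/
theorem integrable_snoc_prod {Φ : UnitAddTorus (Fin (k + 1)) → F} (hΦ : Continuous Φ) :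
    Integrable (fun p : UnitAddCircle × UnitAddTorus (Fin k) => Φ (@Fin.snoc k (fun _ => UnitAddCircle) p.2 p.1))
      ((volume : Measure UnitAddCircle).prod (volume : Measure (UnitAddTorus (Fin k)))) :=
  (hΦ.comp (continuous_snoc_prod k)).integrable_of_hasCompactSupport (HasCompactSupport.of_compactSpace _)

/-- **Fubini, phase outside**: `∫_{T^{k+1}} Φ = ∫_{T¹} ∫_{T^k} Φ (Fin.snoc x s) dx ds` for continuous `Φ`. [folklore] -/
theorem integral_eq_integral_integral_snoc [CompleteSpace F] {Φ : UnitAddTorus (Fin (k + 1)) → F}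
    (hΦ : Continuous Φ) :
    ∫ y, Φ y = ∫ s : UnitAddCircle, ∫ x : UnitAddTorus (Fin k), Φ (@Fin.snoc k (fun _ => UnitAddCircle) x s) := by
  rw [integral_eq_integral_snoc_prod]
  exact integral_prod _ (integrable_snoc_prod hΦ)

/-- **Fubini, phase inside**: `∫_{T^{k+1}} Φ = ∫_{T^k} ∫_{T¹} Φ (Fin.snoc x s) ds dx` for continuous `Φ`. [folklore] -/
theorem integral_eq_integral_integral_snoc' [CompleteSpace F] {Φ : UnitAddTorus (Fin (k + 1)) → F}
    (hΦ : Continuous Φ) :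
    ∫ y, Φ y = ∫ x : UnitAddTorus (Fin k), ∫ s : UnitAddCircle, Φ (@Fin.snoc k (fun _ => UnitAddCircle) x s) := by
  rw [integral_eq_integral_snoc_prod]
  exact integral_prod_symm _ (integrable_snoc_prod hΦ)

end Snoc

/-! ## §3 The evaluation map `e_n = phaseMap j G n` -/

section PhaseMap

variable (j : Fin 3 → ℤ) (G : UnitAddTorus (Fin 3) → ℝ) (n : ℕ)

/-- `slow (e_n x) = x`. [folklore] -/
theorem slow_phaseMap (x : UnitAddTorus (Fin 3)) : slow (phaseMap j G n x) = x := by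
  funext l
  simp only [slow, phaseMap, Fin.snoc_castSucc]

/-- `slow (z + s e_{i.castSucc}) = slow z + s eᵢ`. [folklore] -/
theorem slow_add_single_castSucc (z : UnitAddTorus (Fin 4)) (i : Fin 3) (s : UnitAddCircle) :
    slow (z + Pi.single (Fin.castSucc i) s) = slow z + Pi.single i s := by
  funext l
  simp [slow, Pi.single_apply, Fin.castSucc_inj]

/-- **Translation of the fast phase along a slow axis**:
`θ_n (x + t eᵢ) = θ_n x + ↑((n+1)(jᵢ t + G (x + t eᵢ) − G x))`. [folklore] -/
theorem fastPhase_add_single (x : UnitAddTorus (Fin 3)) (i : Fin 3) (t : ℝ) :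
    fastPhase j G n (x + Pi.single i (t : UnitAddCircle)) =
      fastPhase j G n x +
        ((((n : ℝ) + 1) * ((j i : ℝ) * t + G (x + Pi.single i (t : UnitAddCircle)) - G x) : ℝ) : UnitAddCircle) := by
  unfold fastPhase
  simp only [Pi.add_apply, smul_add, Finset.sum_add_distrib]
  have hs : ∑ l : Fin 3, (((n : ℤ) + 1) * j l) • (Pi.single i (t : UnitAddCircle) : UnitAddTorus (Fin 3)) l =
      (((n : ℤ) + 1) * j i) • ((t : ℝ) : UnitAddCircle) := by
    simp [Pi.single_apply]
  rw [hs, zsmul_coe_unitAddCircle, add_assoc, add_assoc, ← AddCircle.coe_add, ← AddCircle.coe_add]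
  congr 1
  push_cast
  ring

/-- **Translation identity for the evaluation map**:
`e_n (x + t eᵢ) = e_n x + t e_{i.castSucc} + ((n+1)(jᵢ t + G (x + t eᵢ) − G x)) e_θ`. [folklore] -/
theorem phaseMap_add_single (x : UnitAddTorus (Fin 3)) (i : Fin 3) (t : ℝ) :
    phaseMap j G n (x + Pi.single i (t : UnitAddCircle)) =
      phaseMap j G n x + Pi.single (Fin.castSucc i) (t : UnitAddCircle) +
        Pi.single (Fin.last 3)
          ((((n : ℝ) + 1) * ((j i : ℝ) * t + G (x + Pi.single i (t : UnitAddCircle)) - G x) : ℝ) : UnitAddCircle) := by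
  funext m
  refine Fin.lastCases ?_ (fun l => ?_) m
  · simp only [phaseMap, Fin.snoc_last, Pi.add_apply, Pi.single_eq_same,
      Pi.single_eq_of_ne (Fin.castSucc_lt_last i).ne', add_zero]
    exact fastPhase_add_single j G n x i t
  · simp only [phaseMap, Fin.snoc_castSucc, Pi.add_apply, Pi.single_eq_of_ne (Fin.castSucc_lt_last l).ne, add_zero]
    rw [Pi.single_apply, Pi.single_apply]
    simp only [Fin.castSucc_inj]

variable {G}

/-- The fast phase is continuous for continuous `G`. [folklore] -/
theorem continuous_fastPhase (hG : Continuous G) : Continuous (fastPhase j G n) := by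
  unfold fastPhase
  refine (continuous_finsetSum _ fun l _ => ?_).add (continuous_quotient_mk'.comp (continuous_const.mul hG))
  exact (continuous_apply l).zsmul _

/-- The evaluation map `e_n` is continuous for continuous `G`. [folklore] -/
theorem continuous_phaseMap (hG : Continuous G) : Continuous (phaseMap j G n) := by
  refine continuous_pi fun m => ?_
  refine Fin.lastCases ?_ (fun l => ?_) m
  · simp only [phaseMap, Fin.snoc_last]
    exact continuous_fastPhase j n hG
  · simp only [phaseMap, Fin.snoc_castSucc]
    exact continuous_apply l

/-- The phase gradient `kᵢ = ∂ᵢG + jᵢ` is smooth for smooth `G`. [folklore] -/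
theorem isSmooth_phaseGrad (hG : IsSmooth G) (i : Fin 3) : IsSmooth (phaseGrad j G i) :=
  (hG.partialDeriv i).add (isSmooth_const (j i : ℝ))

/-! ## §4 The first-order chain rule through `e_n` -/

/-- Derivative of the phase increment `g(t) = (n+1)(jᵢ t + G(x + t eᵢ) − G x)` at `t = 0`:
`g'(0) = (n+1) kᵢ(x)`. [folklore] -/
theorem hasDerivAt_phaseIncrement (hG : IsContDiff 1 G) (i : Fin 3) (x : UnitAddTorus (Fin 3)) :
    HasDerivAt (fun t : ℝ => ((n : ℝ) + 1) * ((j i : ℝ) * t + G (x + Pi.single i (t : UnitAddCircle)) - G x))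
      (((n : ℝ) + 1) * phaseGrad j G i x) 0 := by
  have hGd : HasDerivAt (fun t : ℝ => G (x + Pi.single i (t : UnitAddCircle))) (partialDeriv i G x) 0 := by
    have h := hasDerivAt_comp_add_proj_smul hG x (EuclideanSpace.single i (1 : ℝ)) 0
    simp only [zero_smul, proj_zero, add_zero, proj_smul_single] at h
    exact h
  have h : HasDerivAt (fun t : ℝ => ((n : ℝ) + 1) * ((j i : ℝ) * t + G (x + Pi.single i (t : UnitAddCircle)) - G x))
      (((n : ℝ) + 1) * ((j i : ℝ) * 1 + partialDeriv i G x)) 0 :=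
    ((((hasDerivAt_id (0 : ℝ)).const_mul (j i : ℝ)).add hGd).sub_const (G x)).const_mul ((n : ℝ) + 1)
  refine h.congr_deriv ?_
  simp only [phaseGrad, mul_one]
  ring

/-- **First-order chain rule through the evaluation map**: for smooth `Φ : T⁴ → F` and smooth `G`,
`∂ᵢ(Φ ∘ e_n)(x) = ∂_{i.castSucc}Φ (e_n x) + ((n+1) kᵢ(x)) • ∂_θΦ (e_n x)`.  Along the coordinate line,
`e_n (x + proj (t eᵢ)) = e_n x + proj (γ t)` with `γ t = t e_{i.castSucc} + g(t) e_θ`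
(`phaseMap_add_single`), so `Φ ∘ e_n` restricted to the line is `liftAt Φ (e_n x) ∘ γ`. [folklore] -/
theorem partialDeriv_comp_phaseMap {F : Type*} [NormedAddCommGroup F] [NormedSpace ℝ F]
    (hG : IsSmooth G) {Φ : UnitAddTorus (Fin 4) → F} (hΦ : IsSmooth Φ) (i : Fin 3) (x : UnitAddTorus (Fin 3)) :
    partialDeriv i (fun x => Φ (phaseMap j G n x)) x =
      partialDeriv (Fin.castSucc i) Φ (phaseMap j G n x) +
        (((n : ℝ) + 1) * phaseGrad j G i x) • partialDeriv (Fin.last 3) Φ (phaseMap j G n x) := by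
  have hΦ1 : IsContDiff 1 Φ := hΦ.isContDiff (by simp)
  have hG1 : IsContDiff 1 G := hG.isContDiff (by simp)
  set g : ℝ → ℝ := fun t => ((n : ℝ) + 1) * ((j i : ℝ) * t + G (x + Pi.single i (t : UnitAddCircle)) - G x)
    with hg
  set γ : ℝ → EuclideanSpace ℝ (Fin 4) := fun t =>
    t • EuclideanSpace.single (Fin.castSucc i) (1 : ℝ) + g t • EuclideanSpace.single (Fin.last 3) (1 : ℝ) with hγ
  -- the curve identity
  have hcurve : ∀ t : ℝ,
      Φ (phaseMap j G n (x + proj (t • EuclideanSpace.single i (1 : ℝ)))) = liftAt Φ (phaseMap j G n x) (γ t) := by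
    intro t
    rw [liftAt_apply, proj_smul_single, phaseMap_add_single, hγ, hg]
    simp only [proj_add, proj_smul_single, add_assoc]
  -- derivative of the curve at `0`
  have hγ' : HasDerivAt γ (EuclideanSpace.single (Fin.castSucc i) (1 : ℝ) +
      (((n : ℝ) + 1) * phaseGrad j G i x) • EuclideanSpace.single (Fin.last 3) (1 : ℝ)) 0 := by
    have h := ((hasDerivAt_id (0 : ℝ)).smul_const (EuclideanSpace.single (Fin.castSucc i) (1 : ℝ))).add
      ((hasDerivAt_phaseIncrement j n hG1 i x).smul_const (EuclideanSpace.single (Fin.last 3) (1 : ℝ)))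
    rw [one_smul] at h
    exact h
  have hγ0 : γ 0 = 0 := by
    simp [hγ, hg]
  -- the re-centred lift is differentiable at `γ 0 = 0` with derivative `Torus.fderiv Φ (e_n x)`
  have hΦd : HasFDerivAt (liftAt Φ (phaseMap j G n x)) (Torus.fderiv Φ (phaseMap j G n x)) (γ 0) := by
    rw [hγ0]
    exact ((hΦ1.liftAt _).differentiable one_ne_zero).differentiableAt.hasFDerivAt
  have hcomp := hΦd.comp_hasDerivAt (0 : ℝ) hγ'
  calc partialDeriv i (fun x => Φ (phaseMap j G n x)) x
      = deriv (fun t : ℝ => Φ (phaseMap j G n (x + proj (t • EuclideanSpace.single i (1 : ℝ))))) 0 := rfl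
    _ = deriv (liftAt Φ (phaseMap j G n x) ∘ γ) 0 := by
        congr 1
        funext t
        exact hcurve t
    _ = Torus.fderiv Φ (phaseMap j G n x) (EuclideanSpace.single (Fin.castSucc i) (1 : ℝ) +
          (((n : ℝ) + 1) * phaseGrad j G i x) • EuclideanSpace.single (Fin.last 3) (1 : ℝ)) := hcomp.deriv
    _ = _ := by
        rw [map_add, map_smul, ← partialDeriv_eq_fderiv_apply hΦ1, ← partialDeriv_eq_fderiv_apply hΦ1]

end PhaseMap

/-! ## §5 The registered tools stub -/

/-- **stub_dissipationLawWTools** (the registered tools sub-stub of `stub_dissipationLawW`; conjunction of the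
facts exported by this file, at the instances used downstream): mean value inequality and invariance along an
axis, common bounds, representatives of `ℝ/ℤ` in `[0,1)`, `Fin.snoc` bookkeeping and Fubini `T⁴ = T¹ × T³`,
`slow ∘ e_n = id`, the translation identity and continuity of `e_n`, smoothness of `k`, and the first-order
chain rule through `e_n`. [folklore] -/
theorem stub_dissipationLawWTools : (∀ {f : UnitAddTorus (Fin 4) → EuclideanSpace ℝ (Fin 3)}, Literature.Analysis.FunctionSpaces.Torus.IsContDiff 1 f → ∀ (m : Fin 4) {C : ℝ}, (∀ z, ‖Literature.Analysis.FunctionSpaces.Torus.partialDeriv m f z‖ ≤ C) → ∀ (z : UnitAddTorus (Fin 4)) (t : ℝ), ‖f (z + Pi.single m (t : UnitAddCircle)) - f z‖ ≤ C * |t|) ∧ (∀ {f : UnitAddTorus (Fin 3) → ℝ}, Literature.Analysis.FunctionSpaces.Torus.IsContDiff 1 f → ∀ (m : Fin 3), (∀ z, Literature.Analysis.FunctionSpaces.Torus.partialDeriv m f z = 0) → ∀ (z : UnitAddTorus (Fin 3)) (s : UnitAddCircle), f (z + Pi.single m s) = f z) ∧ (∀ (f : Fin 3 → UnitAddTorus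 (Fin 3) → ℝ), (∀ i, Continuous (f i)) → ∃ K : ℝ, 0 ≤ K ∧ ∀ i x, ‖f i x‖ ≤ K) ∧ (∀ s : UnitAddCircle, ∃ r : ℝ, r ∈ Set.Ico (0 : ℝ) 1 ∧ (r : UnitAddCircle) = s) ∧ (∀ (x : UnitAddTorus (Fin 3)) (a b : UnitAddCircle), (@Fin.snoc 3 (fun _ => UnitAddCircle) x a : UnitAddTorus (Fin 4)) + Pi.single (Fin.last 3) b = @Fin.snoc 3 (fun _ => UnitAddCircle) x (a + b)) ∧ (∀ {Φ : UnitAddTorus (Fin 4) → ℝ}, Continuous Φ → MeasureTheory.Integrable (fun p : UnitAddCircle × UnitAddTorus (Fin 3) => Φ (@Fin.snoc 3 (fun _ => UnitAddCircle) p.2 p.1)) ((MeasureTheory.volume : MeasureTheory.Measure UnitAddCircle).prod (MeasureTheory.volume : MeasureTheory.Measure (UnitAddTorus (Fin 3))))) ∧ (∀ {Φ : UnitAddTorus (Fin 4) → ℝ}, Continuous Φ → ∫ y, Φ y = ∫ s : UnitAddCircle, ∫ x : UnitAddTorus (Fin 3), Φ (@Fin.snoc 3 (fun _ => UnitAddCircle)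 x s)) ∧ (∀ {Φ : UnitAddTorus (Fin 4) → ℝ}, Continuous Φ → ∫ y, Φ y = ∫ x : UnitAddTorus (Fin 3), ∫ s : UnitAddCircle, Φ (@Fin.snoc 3 (fun _ => UnitAddCircle) x s)) ∧ (∀ (j : Fin 3 → ℤ) (G : UnitAddTorus (Fin 3) → ℝ) (n : ℕ) (x : UnitAddTorus (Fin 3)), slow (phaseMap j G n x) = x) ∧ (∀ (z : UnitAddTorus (Fin 4)) (i : Fin 3) (s : UnitAddCircle), slow (z + Pi.single (Fin.castSucc i) s) = slow z + Pi.single i s) ∧ (∀ (j : Fin 3 → ℤ) (G : UnitAddTorus (Fin 3) → ℝ) (n : ℕ) (x : UnitAddTorus (Fin 3)) (i : Fin 3) (t : ℝ), phaseMap j G n (x + Pi.single i (t : UnitAddCircle)) = phaseMap j G n x + Pi.single (Fin.castSucc i) (t : UnitAddCircle) + Pi.single (Fin.last 3) ((((n : ℝ) + 1) * ((j i : ℝ) * t + G (x + Pi.single i (t : UnitAddCircle)) - G x) : ℝ) : UnitAddCircle)) ∧ (∀ (j : Fin 3 → ℤ) {G : UnitAddTorus (Fin 3) → ℝ} (n :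 ℕ), Continuous G → Continuous (fastPhase j G n)) ∧ (∀ (j : Fin 3 → ℤ) {G : UnitAddTorus (Fin 3) → ℝ} (n : ℕ), Continuous G → Continuous (phaseMap j G n)) ∧ (∀ (j : Fin 3 → ℤ) {G : UnitAddTorus (Fin 3) → ℝ}, Literature.Analysis.FunctionSpaces.Torus.IsSmooth G → ∀ i : Fin 3, Literature.Analysis.FunctionSpaces.Torus.IsSmooth (phaseGrad j G i)) ∧ (∀ (j : Fin 3 → ℤ) {G : UnitAddTorus (Fin 3) → ℝ} (n : ℕ), Literature.Analysis.FunctionSpaces.Torus.IsSmooth G → ∀ {Φ : UnitAddTorus (Fin 4) → EuclideanSpace ℝ (Fin 3)}, Literature.Analysis.FunctionSpaces.Torus.IsSmooth Φ → ∀ (i : Fin 3) (x : UnitAddTorus (Fin 3)), Literature.Analysis.FunctionSpaces.Torus.partialDeriv i (fun x => Φ (phaseMap j G n x)) x = Literature.Analysis.FunctionSpaces.Torus.partialDeriv (Fin.castSucc i) Φ (phaseMap j G n x) + (((n : ℝ) + 1) * phaseGrad j G i x) • Literature.Analysis.FunctionSpaces.Torus.partialDeriv (Fin.last 3) Φ (phaseMap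 j G n x)) :=
  ⟨norm_sub_le_of_norm_partialDeriv_le, apply_add_single_eq_of_partialDeriv_eq_zero, exists_forall_norm_le, exists_mem_Ico_coe_eq,
    snoc_add_single_last, integrable_snoc_prod, integral_eq_integral_integral_snoc, integral_eq_integral_integral_snoc',
    slow_phaseMap, slow_add_single_castSucc, phaseMap_add_single,
    fun j _ n hG => continuous_fastPhase j n hG, fun j _ n hG => continuous_phaseMap j n hG,
    fun j _ hG => isSmooth_phaseGrad j hG, fun j _ n hG _ hΦ => partialDeriv_comp_phaseMap j n hG hΦ⟩


end Summit.AnomalousDissipation.AnomalousDissipation.Theorems.TaylorWaveQuasiSteady.DissipationLaw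

end
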